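import Summits.BirchSwinnertonDyer.Rank1Residual.X10.CasselsTatePairingRecordsMinimality
import HarnessLib

/-!
# CTP-on-Sel³ instrument records, part G: THEOREM-backed NON-ZERO controls BEYOND Cremona's table on the 3Ns path — nine-type CM twists with the EXACT analytic order (cell `b2b-bsdres`, unit `b2b-bsdres-x10`, gen 16)

HONEST FRAMING (run/shared/lean/b2b/bsd-rank1-residual/, verbatim in every file): the goal of the
cell is to DELETE the COMBINATION-SHAPED residual classes of the Birch–Swinnerton-Dyer formula for
ALL analytic-rank `≤ 1` elliptic curves over `ℚ` — "full BSD formula for every rank `≤ 1` curve in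
class `C`" assembled STRICTLY from published theorems — so that the rank-`≤ 1` remainder becomes
exactly the CONSTRUCTION-SHAPED classes, which are TYPED (missing-input `Prop`s), NOT attempted.
This is not "finishing BSD". Theorems only (no definition, no named fact); NOTHING IS BOOKED here;
no class label changes. Per pair. The curves of this file are CM curves and lie in NO residual class
of the cell (CM rank `0` is covered in print); they are recorded ONLY as instrument CONTROLS.

**What this file is.** Part E recorded the one THEOREM-backed NON-ZERO control on the 3Ns path
INSIDE Cremona's table (`350464h1`: Rubin 1991 Thm. 12.3 × Cremona's exact `#Ш_an = 9` × two-engine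
`dim Sel^(3) = 2` ⇒ non-degenerate pairing; route A's `G` alternating non-zero). Gen 16 removed the
restriction to Cremona's table: Birch's twisted modular-symbol formula at the BASE level
`N₀ ∈ {121, 256}` (Cremona, *Algorithms* 2nd ed. §2.11) with exact period scaling and ONE rational
constant per (base, sign), calibrated on a Cremona twist with `N ≤ 60 000` and re-verified EXACTLY
on 37 further Cremona twists, gives `L(E^D,1)/Ω` and `#Ш_an` EXACTLY for every quadratic twist of
`121b1` / `256a1` / `256d1` by a fundamental `D` with `(D, N₀) = 1` (kit j142794; an independent
pure-Python modular-symbol ENGINE 2, kit j143044, agrees on all 6 839 twists; write-up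
`HOME/b2b-bsdres-x10/g16/exact/EXACT-LVALUES.md`). For the nine-type CM twists below (analytic
rank `0`, `#Ш_an = 9` EXACT, no `3`-torsion, `dim_𝔽₃ Sel^(3) = 2` by x10b's two engines, kit j142831)
Rubin's theorem gives `ord₃ #Ш = 2 = dim Sel^(3)`, hence `Ш[3^∞] = Ш[3] ≅ (ℤ/3)²` and the
Cassels–Tate pairing on `Sel^(3) = Ш[3]` is NON-degenerate — the prediction BY THEOREM is an
alternating NON-ZERO Gram matrix, now for curves OUTSIDE Cremona's table. Route A returned
`G = [[0,1],[2,0]]` (alternating, rank `2`) on each curve recorded here — the controls PASS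
(documents under `HOME/b2b-bsdres-x10/g16/ctp-sel3/cmnine/certs/`, selfcheck PASS, forced hub runs
of verifier B's reader-of-record code agree row for row — non-authoritative; B has NOT read them of
record). As in parts A–E the records below are written in the class-free shapes of
`CasselsTatePairingRecords` so that the kernel decides the side facts (`Δ ≠ 0`, global minimality
by the support-based Kraus criterion, irreducibility of `E[3]` by a Frobenius witness `ℓ = 7`,
`#Ẽ(𝔽₇) = 8`); the pairing binders displayed are PRECISELY the content of the documents; `hcard` is
the two-engine descent line; `hr`/`hv` come from the EXACT value (`L(E,1)/Ω = 18 ≠ 0`, `#Ш_an = 9`).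
No theorem of this file uses Rubin's theorem — the THEOREM side lives in the cited Literature module
(tree `Rubin1991.pPartRankZero_of_cm`); here it only explains why these records are CONTROLS.

**Status of the displayed binders.** `hGZK` (published); `hr : r_an = 0` (exact non-zero value);
`hcard : #Sel^(3) = 9` (x10b's two engines, exact, j142831); the PAIRING binders = the ctp-sel3/1.1
documents (route A only; verifier B unread of record); `hv : ord₃ #Ш_an = 2` (EXACT, gen 16,
j142794 / j143044). These theorems book nothing.

References: as in part A — Cassels 1998 §1 [Cassels1998]; Fisher–Newton 2014 Thm. 1.3
[FisherNewton2014]; Miller 2011 Def. 1.1 [Miller2011LMS]; Mazur 1978 Prop. 6.3 (1) [Mazur1978];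
Kraus 1989 [Kraus1989]; Silverman AEC VII Rem. 1.1 [SilvermanAEC2009]; K. Rubin, Invent. Math. 103
(1991) 25–68, Thm. 12.3 [Rubin1991]; J. E. Cremona, *Algorithms for Modular Elliptic Curves* (2nd
ed., 1997) §2.11; cell files X10-AUDIT.md §22, `HOME/b2b-bsdres-x10/g16/`.
-/

set_option autoImplicit false

noncomputable section

open scoped Classical

open WeierstrassCurve Literature.NumberTheory.EllipticCurves
  Literature.NumberTheory.EllipticCurves.Rank1Residual
  Literature.NumberTheory.EllipticCurves.Rank1Residual.Typed
  Literature.NumberTheory.EllipticCurves.Rank1Residual.X11RankOneCertificates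
  Summit.BirchSwinnertonDyer.BirchSwinnertonDyer.Rank1Residual.IntModel
  Summit.BirchSwinnertonDyer.BirchSwinnertonDyer.Rank1Residual.X11RankOne
  Summit.BirchSwinnertonDyer.Rank1Residual.X11b

namespace Summit.BirchSwinnertonDyer.Rank1Residual.X10

/-! ### §1. Frobenius point-count witnesses for irreducibility of `E[3]` (kernel-decided data; `ℓ = 7` is inert in the CM field and `≡ 1 mod 3`) -/

/-- `#Ẽ(𝔽₇) = 8` (`a₇ = 0`; `X² + 7` is root-free mod `3`) for the minimal model `[0, 1, 1, -96983, -11959931]` of the CM twist `c121b1Dm115` = `121b1 ⊗ χ_{-115}` (kernel count). [folklore] -/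
theorem card_c121b1Dm115_7 :
    Nat.card (((⟨0, 1, 1, (-96983), (-11959931)⟩ : WeierstrassCurve ℤ).map (Int.castRingHom (ZMod 7))).toAffine.Point) = 8 := by
  rw [@WeierstrassCurve.natCard_point_eq_one_add_card (ZMod 7) (@ZMod.instField 7 ⟨by norm_num⟩) _ _ _
    (by decide +kernel), @card_sol_eq_sum_euler (ZMod 7) (@ZMod.instField 7 ⟨by norm_num⟩) _ _
    (by rw [ZMod.ringChar_zmod_n]; decide), ZMod.card]
  decide +kernel

/-- `#Ẽ(𝔽₇) = 8` (`a₇ = 0`; `X² + 7` is root-free mod `3`) for the minimal model `[0, -1, 0, -28189, -1859713]` of the CM twist `c121b1Dm248` = `121b1 ⊗ χ_{-248}` (kernel count). [folklore] -/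
theorem card_c121b1Dm248_7 :
    Nat.card (((⟨0, (-1), 0, (-28189), (-1859713)⟩ : WeierstrassCurve ℤ).map (Int.castRingHom (ZMod 7))).toAffine.Point) = 8 := by
  rw [@WeierstrassCurve.natCard_point_eq_one_add_card (ZMod 7) (@ZMod.instField 7 ⟨by norm_num⟩) _ _ _
    (by decide +kernel), @card_sol_eq_sum_euler (ZMod 7) (@ZMod.instField 7 ⟨by norm_num⟩) _ _
    (by rw [ZMod.ringChar_zmod_n]; decide), ZMod.card]
  decide +kernel

/-! ### §2. The records, in two shapes (class-free consumers `padicValNat_shaOrder_three_eq_two_of_ainvs_of_ctpGram` / `bsdp_three_of_ainvs_of_ctpGram`; minimality and `Δ ≠ 0` kernel-decided per record) -/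

/-- **`c121b1Dm115` (THEOREM-backed NON-ZERO control beyond Cremona): the exact `3`-part `ord₃ #Ш(E/ℚ) = 2` (`#Ш[3^∞] = 9`) from the CTP-on-Sel³ certificate shape WITHOUT any analytic `Ш` value** — for this curve the same conclusion is a THEOREM by Rubin 1991 × the exact value
(`N = 1600225 = 5²·11²·23²`, BEYOND Cremona's table: CM by ℤ[(1+√−11)/2] (j = −32768); good ORDINARY at 3 (`a₃ = 1`); a CONTROL curve, in NO residual class of the cell; minimal model `[0, 1, 1, -96983, -11959931]` of `c121b1Dm115` = `121b1 ⊗ χ_{-115}`; `ρ̄_{E,3}` irreducible, NOT surjective, image `3Ns`; analytic rank `0`,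
**`L(E,1)/Ω = 18` and `#Ш_an = 9` EXACT** (gen 16: Birch twisted modular symbols at level 121, kit j142794; engine 2 j143044) — and `ord₃ #Ш = 2` a THEOREM by Rubin 1991 Thm. 12.3 (module docstring); `∏ c_ℓ = 2`, `#E(ℚ)_tors = 1`).
Displayed binders: `hGZK`; `r_an = 0`; `hcard` = the exact two-engine `3`-descent line `dim_𝔽₃ Sel^(3)(E/ℚ) = 2` (x10b `desc3ns` + `desc3ns_e2`, kit j142831, bnfcertify = 1, cross-checks true); the pairing binders = the ctp-sel3/1.1
TARGET-shaped document of this curve in `HOME/b2b-bsdres-x10/g16/ctp-sel3/cmnine/certs/` (route A's G = `[[0, 1], [2, 0]]` — alternating, rank 2, NON-ZERO = the THEOREM-side prediction; document `ctp_cert_c121b1Dm115.json` sha16 `8f983fb8aeff6607`,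
chain j142879; forced run of B's ctpB-0.7.10.5-M2h reader code agrees on all 234 rows (232 + 2 n/a), B's own G = [[0,1],[2,0]], non-authoritative; VERIFIER B UNREAD OF RECORD; outside the R-281(d) exception; nothing is booked on it).
Kernel-decided here: `Δ ≠ 0`; global minimality by x11c's support-based criterion `X11b.isGloballyMinimal_of_krausCriterion_support` (support `[(5, 2, 6), (11, 2, 3), (23, 2, 6)]` = (prime, conductor exponent, `v_p(Δ)`));
`E[3]` irreducible (`ℓ = 7`, `#Ẽ(𝔽₇) = 8`, `a₇ = 0`). Per pair; books nothing.
[cite: Miller2011LMS, Def. 1.1] [cite: FisherNewton2014, Thm. 1.3] [cite: Kraus1989, Prop. 2] [cite: Mazur1978, §6 Prop. 6.3 (1) (p. 153)] -/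
theorem padicValNat_shaOrder_c121b1Dm115 (hGZK : rank_eq_analyticRank_of_analyticRank_le_one)
    (W : WeierstrassCurve ℚ) (hW : W = ⟨0, 1, 1, (-96983), (-11959931)⟩)
    (hr : W.analyticRank = 0) (hcard : Nat.card (W.selmerGroup (3 : ℤ)) = 9)
    {Q : Type*} [AddCommGroup Q] (B : W.sha →+ W.sha →+ Q) {x₁ x₂ : W.sha}
    (hx₁ : 3 • x₁ = 0) (hx₂ : 3 • x₂ = 0)
    (h₁₁ : B x₁ x₁ = 0) (h₂₂ : B x₂ x₂ = 0) (h₁₂ : B x₁ x₂ ≠ 0) (h₂₁ : B x₂ x₁ ≠ 0) :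
    padicValNat 3 W.shaOrder = 2 := by
  subst hW
  have hE := isElliptic_of_discOf_ne_zero 0 1 1 (-96983) (-11959931) (by decide +kernel)
  have hM := X11b.isGloballyMinimal_of_krausCriterion_support 0 1 1 (-96983) (-11959931)
    [(5, 2, 6), (11, 2, 3), (23, 2, 6)] (by decide +kernel) (by decide +kernel) (by decide +kernel)
  haveI : Fact (Nat.Prime 7) := ⟨by norm_num⟩
  exact @padicValNat_shaOrder_three_eq_two_of_ainvs_of_ctpGram hGZK 0 1 1 (-96983) (-11959931) _ hE hM
    (@integralModelInt_eq_of_map_eq _ hM _ (map_mk_int _ _ _ _ _)) 7 8 _ (by decide) (by decide +kernel)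
    card_c121b1Dm115_7 (by decide +kernel) hr hcard Q _ B x₁ x₂ hx₁ hx₂ h₁₁ h₂₂ h₁₂ h₂₁

/-- **`BSD(E,3)` for `c121b1Dm115` (THEOREM-backed NON-ZERO control beyond Cremona) from the CTP-on-Sel³ certificate shape** — the same binders plus `hv : ord₃ #Ш_an = 2` (EXACT, gen 16); for this CM curve `BSD(E,3)` is ALSO a theorem in print (Rubin 1991), which is what makes it a control
(`N = 1600225 = 5²·11²·23²`, BEYOND Cremona's table: CM by ℤ[(1+√−11)/2] (j = −32768); good ORDINARY at 3 (`a₃ = 1`); a CONTROL curve, in NO residual class of the cell; minimal model `[0, 1, 1, -96983, -11959931]` of `c121b1Dm115` = `121b1 ⊗ χ_{-115}`; `ρ̄_{E,3}` irreducible, NOT surjective, image `3Ns`; analytic rank `0`,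
**`L(E,1)/Ω = 18` and `#Ш_an = 9` EXACT** (gen 16: Birch twisted modular symbols at level 121, kit j142794; engine 2 j143044) — and `ord₃ #Ш = 2` a THEOREM by Rubin 1991 Thm. 12.3 (module docstring); `∏ c_ℓ = 2`, `#E(ℚ)_tors = 1`).
Displayed binders: `hGZK`; `r_an = 0`; `hcard` = the exact two-engine `3`-descent line `dim_𝔽₃ Sel^(3)(E/ℚ) = 2` (x10b `desc3ns` + `desc3ns_e2`, kit j142831, bnfcertify = 1, cross-checks true); the pairing binders = the ctp-sel3/1.1
TARGET-shaped document of this curve in `HOME/b2b-bsdres-x10/g16/ctp-sel3/cmnine/certs/` (route A's G = `[[0, 1], [2, 0]]` — alternating, rank 2, NON-ZERO = the THEOREM-side prediction; document `ctp_cert_c121b1Dm115.json` sha16 `8f983fb8aeff6607`,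
chain j142879; forced run of B's ctpB-0.7.10.5-M2h reader code agrees on all 234 rows (232 + 2 n/a), B's own G = [[0,1],[2,0]], non-authoritative; VERIFIER B UNREAD OF RECORD; outside the R-281(d) exception; nothing is booked on it).
Kernel-decided here: `Δ ≠ 0`; global minimality by x11c's support-based criterion `X11b.isGloballyMinimal_of_krausCriterion_support` (support `[(5, 2, 6), (11, 2, 3), (23, 2, 6)]` = (prime, conductor exponent, `v_p(Δ)`));
`E[3]` irreducible (`ℓ = 7`, `#Ẽ(𝔽₇) = 8`, `a₇ = 0`). Per pair; books nothing.
[cite: Miller2011LMS, Def. 1.1] [cite: FisherNewton2014, Thm. 1.3] [cite: Kraus1989, Prop. 2] [cite: Mazur1978, §6 Prop. 6.3 (1) (p. 153)] -/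
theorem bsdp_c121b1Dm115 (hGZK : rank_eq_analyticRank_of_analyticRank_le_one)
    (W : WeierstrassCurve ℚ) (hW : W = ⟨0, 1, 1, (-96983), (-11959931)⟩)
    (hr : W.analyticRank = 0) (hcard : Nat.card (W.selmerGroup (3 : ℤ)) = 9)
    {Q : Type*} [AddCommGroup Q] (B : W.sha →+ W.sha →+ Q) {x₁ x₂ : W.sha}
    (hx₁ : 3 • x₁ = 0) (hx₂ : 3 • x₂ = 0)
    (h₁₁ : B x₁ x₁ = 0) (h₂₂ : B x₂ x₂ = 0) (h₁₂ : B x₁ x₂ ≠ 0) (h₂₁ : B x₂ x₁ ≠ 0)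
    {q : ℚ} (hq : shaAn W = (q : ℂ)) (hv : padicValRat 3 q = 2) : BSDp W 3 := by
  subst hW
  have hE := isElliptic_of_discOf_ne_zero 0 1 1 (-96983) (-11959931) (by decide +kernel)
  have hM := X11b.isGloballyMinimal_of_krausCriterion_support 0 1 1 (-96983) (-11959931)
    [(5, 2, 6), (11, 2, 3), (23, 2, 6)] (by decide +kernel) (by decide +kernel) (by decide +kernel)
  haveI : Fact (Nat.Prime 7) := ⟨by norm_num⟩
  exact @bsdp_three_of_ainvs_of_ctpGram hGZK 0 1 1 (-96983) (-11959931) _ hE hM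
    (@integralModelInt_eq_of_map_eq _ hM _ (map_mk_int _ _ _ _ _)) 7 8 _ (by decide) (by decide +kernel)
    card_c121b1Dm115_7 (by decide +kernel) hr hcard Q _ B x₁ x₂ hx₁ hx₂ h₁₁ h₂₂ h₁₂ h₂₁ q hq hv

/-- **`c121b1Dm248` (THEOREM-backed NON-ZERO control beyond Cremona): the exact `3`-part `ord₃ #Ш(E/ℚ) = 2` (`#Ш[3^∞] = 9`) from the CTP-on-Sel³ certificate shape WITHOUT any analytic `Ш` value** — for this curve the same conclusion is a THEOREM by Rubin 1991 × the exact value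
(`N = 7441984 = 2⁶·11²·31²`, BEYOND Cremona's table: CM by ℤ[(1+√−11)/2] (j = −32768); good ORDINARY at 3 (`a₃ = -1`); a CONTROL curve, in NO residual class of the cell; minimal model `[0, -1, 0, -28189, -1859713]` of `c121b1Dm248` = `121b1 ⊗ χ_{-248}`; `ρ̄_{E,3}` irreducible, NOT surjective, image `3Ns`; analytic rank `0`,
**`L(E,1)/Ω = 18` and `#Ш_an = 9` EXACT** (gen 16: Birch twisted modular symbols at level 121, kit j142794; engine 2 j143044) — and `ord₃ #Ш = 2` a THEOREM by Rubin 1991 Thm. 12.3 (module docstring); `∏ c_ℓ = 2`, `#E(ℚ)_tors = 1`).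
Displayed binders: `hGZK`; `r_an = 0`; `hcard` = the exact two-engine `3`-descent line `dim_𝔽₃ Sel^(3)(E/ℚ) = 2` (x10b `desc3ns` + `desc3ns_e2`, kit j142831, bnfcertify = 1, cross-checks true); the pairing binders = the ctp-sel3/1.1
TARGET-shaped document of this curve in `HOME/b2b-bsdres-x10/g16/ctp-sel3/cmnine/certs/` (route A's G = `[[0, 1], [2, 0]]` — alternating, rank 2, NON-ZERO = the THEOREM-side prediction; document `ctp_cert_c121b1Dm248.json` sha16 `95d60186be293cf9`,
chain j142886 (eta2) + bundle_a4v5 eta1 re-run j143320 (cert in-job); forced run of B's ctpB-0.7.10.5-M2h reader code agrees on all 247 rows (245 + 2 n/a), B's own G = [[0,1],[2,0]], non-authoritative; VERIFIER B UNREAD OF RECORD; outside the R-281(d) exception; nothing is booked on it).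
Kernel-decided here: `Δ ≠ 0`; global minimality by x11c's support-based criterion `X11b.isGloballyMinimal_of_krausCriterion_support` (support `[(2, 6, 6), (11, 2, 3), (31, 2, 6)]` = (prime, conductor exponent, `v_p(Δ)`));
`E[3]` irreducible (`ℓ = 7`, `#Ẽ(𝔽₇) = 8`, `a₇ = 0`). Per pair; books nothing.
[cite: Miller2011LMS, Def. 1.1] [cite: FisherNewton2014, Thm. 1.3] [cite: Kraus1989, Prop. 2] [cite: Mazur1978, §6 Prop. 6.3 (1) (p. 153)] -/
theorem padicValNat_shaOrder_c121b1Dm248 (hGZK : rank_eq_analyticRank_of_analyticRank_le_one)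
    (W : WeierstrassCurve ℚ) (hW : W = ⟨0, (-1), 0, (-28189), (-1859713)⟩)
    (hr : W.analyticRank = 0) (hcard : Nat.card (W.selmerGroup (3 : ℤ)) = 9)
    {Q : Type*} [AddCommGroup Q] (B : W.sha →+ W.sha →+ Q) {x₁ x₂ : W.sha}
    (hx₁ : 3 • x₁ = 0) (hx₂ : 3 • x₂ = 0)
    (h₁₁ : B x₁ x₁ = 0) (h₂₂ : B x₂ x₂ = 0) (h₁₂ : B x₁ x₂ ≠ 0) (h₂₁ : B x₂ x₁ ≠ 0) :
    padicValNat 3 W.shaOrder = 2 := by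
  subst hW
  have hE := isElliptic_of_discOf_ne_zero 0 (-1) 0 (-28189) (-1859713) (by decide +kernel)
  have hM := X11b.isGloballyMinimal_of_krausCriterion_support 0 (-1) 0 (-28189) (-1859713)
    [(2, 6, 6), (11, 2, 3), (31, 2, 6)] (by decide +kernel) (by decide +kernel) (by decide +kernel)
  haveI : Fact (Nat.Prime 7) := ⟨by norm_num⟩
  exact @padicValNat_shaOrder_three_eq_two_of_ainvs_of_ctpGram hGZK 0 (-1) 0 (-28189) (-1859713) _ hE hM
    (@integralModelInt_eq_of_map_eq _ hM _ (map_mk_int _ _ _ _ _)) 7 8 _ (by decide) (by decide +kernel)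
    card_c121b1Dm248_7 (by decide +kernel) hr hcard Q _ B x₁ x₂ hx₁ hx₂ h₁₁ h₂₂ h₁₂ h₂₁

/-- **`BSD(E,3)` for `c121b1Dm248` (THEOREM-backed NON-ZERO control beyond Cremona) from the CTP-on-Sel³ certificate shape** — the same binders plus `hv : ord₃ #Ш_an = 2` (EXACT, gen 16); for this CM curve `BSD(E,3)` is ALSO a theorem in print (Rubin 1991), which is what makes it a control
(`N = 7441984 = 2⁶·11²·31²`, BEYOND Cremona's table: CM by ℤ[(1+√−11)/2] (j = −32768); good ORDINARY at 3 (`a₃ = -1`); a CONTROL curve, in NO residual class of the cell; minimal model `[0, -1, 0, -28189, -1859713]` of `c121b1Dm248` = `121b1 ⊗ χ_{-248}`; `ρ̄_{E,3}` irreducible, NOT surjective, image `3Ns`; analytic rank `0`,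
**`L(E,1)/Ω = 18` and `#Ш_an = 9` EXACT** (gen 16: Birch twisted modular symbols at level 121, kit j142794; engine 2 j143044) — and `ord₃ #Ш = 2` a THEOREM by Rubin 1991 Thm. 12.3 (module docstring); `∏ c_ℓ = 2`, `#E(ℚ)_tors = 1`).
Displayed binders: `hGZK`; `r_an = 0`; `hcard` = the exact two-engine `3`-descent line `dim_𝔽₃ Sel^(3)(E/ℚ) = 2` (x10b `desc3ns` + `desc3ns_e2`, kit j142831, bnfcertify = 1, cross-checks true); the pairing binders = the ctp-sel3/1.1
TARGET-shaped document of this curve in `HOME/b2b-bsdres-x10/g16/ctp-sel3/cmnine/certs/` (route A's G = `[[0, 1], [2, 0]]` — alternating, rank 2, NON-ZERO = the THEOREM-side prediction; document `ctp_cert_c121b1Dm248.json` sha16 `95d60186be293cf9`,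
chain j142886 (eta2) + bundle_a4v5 eta1 re-run j143320 (cert in-job); forced run of B's ctpB-0.7.10.5-M2h reader code agrees on all 247 rows (245 + 2 n/a), B's own G = [[0,1],[2,0]], non-authoritative; VERIFIER B UNREAD OF RECORD; outside the R-281(d) exception; nothing is booked on it).
Kernel-decided here: `Δ ≠ 0`; global minimality by x11c's support-based criterion `X11b.isGloballyMinimal_of_krausCriterion_support` (support `[(2, 6, 6), (11, 2, 3), (31, 2, 6)]` = (prime, conductor exponent, `v_p(Δ)`));
`E[3]` irreducible (`ℓ = 7`, `#Ẽ(𝔽₇) = 8`, `a₇ = 0`). Per pair; books nothing.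
[cite: Miller2011LMS, Def. 1.1] [cite: FisherNewton2014, Thm. 1.3] [cite: Kraus1989, Prop. 2] [cite: Mazur1978, §6 Prop. 6.3 (1) (p. 153)] -/
theorem bsdp_c121b1Dm248 (hGZK : rank_eq_analyticRank_of_analyticRank_le_one)
    (W : WeierstrassCurve ℚ) (hW : W = ⟨0, (-1), 0, (-28189), (-1859713)⟩)
    (hr : W.analyticRank = 0) (hcard : Nat.card (W.selmerGroup (3 : ℤ)) = 9)
    {Q : Type*} [AddCommGroup Q] (B : W.sha →+ W.sha →+ Q) {x₁ x₂ : W.sha}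
    (hx₁ : 3 • x₁ = 0) (hx₂ : 3 • x₂ = 0)
    (h₁₁ : B x₁ x₁ = 0) (h₂₂ : B x₂ x₂ = 0) (h₁₂ : B x₁ x₂ ≠ 0) (h₂₁ : B x₂ x₁ ≠ 0)
    {q : ℚ} (hq : shaAn W = (q : ℂ)) (hv : padicValRat 3 q = 2) : BSDp W 3 := by
  subst hW
  have hE := isElliptic_of_discOf_ne_zero 0 (-1) 0 (-28189) (-1859713) (by decide +kernel)
  have hM := X11b.isGloballyMinimal_of_krausCriterion_support 0 (-1) 0 (-28189) (-1859713)
    [(2, 6, 6), (11, 2, 3), (31, 2, 6)] (by decide +kernel) (by decide +kernel) (by decide +kernel)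
  haveI : Fact (Nat.Prime 7) := ⟨by norm_num⟩
  exact @bsdp_three_of_ainvs_of_ctpGram hGZK 0 (-1) 0 (-28189) (-1859713) _ hE hM
    (@integralModelInt_eq_of_map_eq _ hM _ (map_mk_int _ _ _ _ _)) 7 8 _ (by decide) (by decide +kernel)
    card_c121b1Dm248_7 (by decide +kernel) hr hcard Q _ B x₁ x₂ hx₁ hx₂ h₁₁ h₂₂ h₁₂ h₂₁ q hq hv

/-! ### §3. Addendum (documents that arrived after the first landing of this part; append-only) -/

/-- `#Ẽ(𝔽₇) = 8` (`a₇ = 0`; `X² + 7` is root-free mod `3`) for the minimal model `[0, -1, 0, -203363, -31186897]` of the CM twist `c256a1Dm247` = `256a1 ⊗ χ_{-247}` (kernel count). [folklore] -/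
    theorem card_c256a1Dm247_7 :
        Nat.card (((⟨0, (-1), 0, (-203363), (-31186897)⟩ : WeierstrassCurve ℤ).map (Int.castRingHom (ZMod 7))).toAffine.Point) = 8 := by
      rw [@WeierstrassCurve.natCard_point_eq_one_add_card (ZMod 7) (@ZMod.instField 7 ⟨by norm_num⟩) _ _ _
        (by decide +kernel), @card_sol_eq_sum_euler (ZMod 7) (@ZMod.instField 7 ⟨by norm_num⟩) _ _
        (by rw [ZMod.ringChar_zmod_n]; decide), ZMod.card]
      decide +kernel
    
/-- **`c256a1Dm247` (THEOREM-backed NON-ZERO control beyond Cremona): the exact `3`-part `ord₃ #Ш(E/ℚ) = 2` (`#Ш[3^∞] = 9`) from the CTP-on-Sel³ certificate shape WITHOUT any analytic `Ш` value** — for this curve the same conclusion is a THEOREM by Rubin 1991 × the exact value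
    (`N = 15618304 = 2⁸·13²·19²`, BEYOND Cremona's table: CM by ℤ[√−2] (j = 8000); good ORDINARY at 3 (`a₃ = 2`); a CONTROL curve, in NO residual class of the cell; minimal model `[0, -1, 0, -203363, -31186897]` of `c256a1Dm247` = `256a1 ⊗ χ_{-247}`; `ρ̄_{E,3}` irreducible, NOT surjective, image `3Ns`; analytic rank `0`,
    **`L(E,1)/Ω = 18` and `#Ш_an = 9` EXACT** (gen 16: Birch twisted modular symbols at level 256, kit j142794; engine 2 j143044) — and `ord₃ #Ш = 2` a THEOREM by Rubin 1991 Thm. 12.3 (module docstring); `∏ c_ℓ = 8`, `#E(ℚ)_tors = 2`).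
    Displayed binders: `hGZK`; `r_an = 0`; `hcard` = the exact two-engine `3`-descent line `dim_𝔽₃ Sel^(3)(E/ℚ) = 2` (x10b `desc3ns` + `desc3ns_e2`, kit j143845, bnfcertify = 1, cross-checks true); the pairing binders = the ctp-sel3/1.1
    TARGET-shaped document of this curve in `HOME/b2b-bsdres-x10/g16/ctp-sel3/cmnine/certs/` (route A's G = `[[0, 1], [2, 0]]` — alternating, rank 2, NON-ZERO = the THEOREM-side prediction; document `ctp_cert_c256a1Dm247.json` sha16 `0232c48ec7ce2afa`,
    chain j143853 (v2 search missed both eta) + bundle_a4v5 A4 runs j143957 (eta1) / j143963 (eta2) + bundle_cert j144347; dim Sel3 front end j143845; forced run of B's ctpB-0.7.10.5-M2h reader code agrees on all 175 rows (173 + 2 n/a), B's own G = [[0,1],[2,0]], non-authoritative; VERIFIER B UNREAD OF RECORD; outside the R-281(d) exception; nothing is booked on it).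
    Kernel-decided here: `Δ ≠ 0`; global minimality by x11c's support-based criterion `X11b.isGloballyMinimal_of_krausCriterion_support` (support `[(2, 8, 9), (13, 2, 6), (19, 2, 6)]` = (prime, conductor exponent, `v_p(Δ)`));
    `E[3]` irreducible (`ℓ = 7`, `#Ẽ(𝔽₇) = 8`, `a₇ = 0`). Per pair; books nothing.
    [cite: Miller2011LMS, Def. 1.1] [cite: FisherNewton2014, Thm. 1.3] [cite: Kraus1989, Prop. 2] [cite: Mazur1978, §6 Prop. 6.3 (1) (p. 153)] -/
    theorem padicValNat_shaOrder_c256a1Dm247 (hGZK : rank_eq_analyticRank_of_analyticRank_le_one)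
        (W : WeierstrassCurve ℚ) (hW : W = ⟨0, (-1), 0, (-203363), (-31186897)⟩)
        (hr : W.analyticRank = 0) (hcard : Nat.card (W.selmerGroup (3 : ℤ)) = 9)
        {Q : Type*} [AddCommGroup Q] (B : W.sha →+ W.sha →+ Q) {x₁ x₂ : W.sha}
        (hx₁ : 3 • x₁ = 0) (hx₂ : 3 • x₂ = 0)
        (h₁₁ : B x₁ x₁ = 0) (h₂₂ : B x₂ x₂ = 0) (h₁₂ : B x₁ x₂ ≠ 0) (h₂₁ : B x₂ x₁ ≠ 0) :
        padicValNat 3 W.shaOrder = 2 := by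
      subst hW
      have hE := isElliptic_of_discOf_ne_zero 0 (-1) 0 (-203363) (-31186897) (by decide +kernel)
      have hM := X11b.isGloballyMinimal_of_krausCriterion_support 0 (-1) 0 (-203363) (-31186897)
        [(2, 8, 9), (13, 2, 6), (19, 2, 6)] (by decide +kernel) (by decide +kernel) (by decide +kernel)
      haveI : Fact (Nat.Prime 7) := ⟨by norm_num⟩
      exact @padicValNat_shaOrder_three_eq_two_of_ainvs_of_ctpGram hGZK 0 (-1) 0 (-203363) (-31186897) _ hE hM
        (@integralModelInt_eq_of_map_eq _ hM _ (map_mk_int _ _ _ _ _)) 7 8 _ (by decide) (by decide +kernel)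
        card_c256a1Dm247_7 (by decide +kernel) hr hcard Q _ B x₁ x₂ hx₁ hx₂ h₁₁ h₂₂ h₁₂ h₂₁
    
    /-- **`BSD(E,3)` for `c256a1Dm247` (THEOREM-backed NON-ZERO control beyond Cremona) from the CTP-on-Sel³ certificate shape** — the same binders plus `hv : ord₃ #Ш_an = 2` (EXACT, gen 16); for this CM curve `BSD(E,3)` is ALSO a theorem in print (Rubin 1991), which is what makes it a control
    (`N = 15618304 = 2⁸·13²·19²`, BEYOND Cremona's table: CM by ℤ[√−2] (j = 8000); good ORDINARY at 3 (`a₃ = 2`); a CONTROL curve, in NO residual class of the cell; minimal model `[0, -1, 0, -203363, -31186897]` of `c256a1Dm247` = `256a1 ⊗ χ_{-247}`; `ρ̄_{E,3}` irreducible, NOT surjective, image `3Ns`; analytic rank `0`,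
    **`L(E,1)/Ω = 18` and `#Ш_an = 9` EXACT** (gen 16: Birch twisted modular symbols at level 256, kit j142794; engine 2 j143044) — and `ord₃ #Ш = 2` a THEOREM by Rubin 1991 Thm. 12.3 (module docstring); `∏ c_ℓ = 8`, `#E(ℚ)_tors = 2`).
    Displayed binders: `hGZK`; `r_an = 0`; `hcard` = the exact two-engine `3`-descent line `dim_𝔽₃ Sel^(3)(E/ℚ) = 2` (x10b `desc3ns` + `desc3ns_e2`, kit j143845, bnfcertify = 1, cross-checks true); the pairing binders = the ctp-sel3/1.1
    TARGET-shaped document of this curve in `HOME/b2b-bsdres-x10/g16/ctp-sel3/cmnine/certs/` (route A's G = `[[0, 1], [2, 0]]` — alternating, rank 2, NON-ZERO = the THEOREM-side prediction; document `ctp_cert_c256a1Dm247.json` sha16 `0232c48ec7ce2afa`,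
    chain j143853 (v2 search missed both eta) + bundle_a4v5 A4 runs j143957 (eta1) / j143963 (eta2) + bundle_cert j144347; dim Sel3 front end j143845; forced run of B's ctpB-0.7.10.5-M2h reader code agrees on all 175 rows (173 + 2 n/a), B's own G = [[0,1],[2,0]], non-authoritative; VERIFIER B UNREAD OF RECORD; outside the R-281(d) exception; nothing is booked on it).
    Kernel-decided here: `Δ ≠ 0`; global minimality by x11c's support-based criterion `X11b.isGloballyMinimal_of_krausCriterion_support` (support `[(2, 8, 9), (13, 2, 6), (19, 2, 6)]` = (prime, conductor exponent, `v_p(Δ)`));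
    `E[3]` irreducible (`ℓ = 7`, `#Ẽ(𝔽₇) = 8`, `a₇ = 0`). Per pair; books nothing.
    [cite: Miller2011LMS, Def. 1.1] [cite: FisherNewton2014, Thm. 1.3] [cite: Kraus1989, Prop. 2] [cite: Mazur1978, §6 Prop. 6.3 (1) (p. 153)] -/
    theorem bsdp_c256a1Dm247 (hGZK : rank_eq_analyticRank_of_analyticRank_le_one)
        (W : WeierstrassCurve ℚ) (hW : W = ⟨0, (-1), 0, (-203363), (-31186897)⟩)
        (hr : W.analyticRank = 0) (hcard : Nat.card (W.selmerGroup (3 : ℤ)) = 9)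
        {Q : Type*} [AddCommGroup Q] (B : W.sha →+ W.sha →+ Q) {x₁ x₂ : W.sha}
        (hx₁ : 3 • x₁ = 0) (hx₂ : 3 • x₂ = 0)
        (h₁₁ : B x₁ x₁ = 0) (h₂₂ : B x₂ x₂ = 0) (h₁₂ : B x₁ x₂ ≠ 0) (h₂₁ : B x₂ x₁ ≠ 0)
        {q : ℚ} (hq : shaAn W = (q : ℂ)) (hv : padicValRat 3 q = 2) : BSDp W 3 := by
      subst hW
      have hE := isElliptic_of_discOf_ne_zero 0 (-1) 0 (-203363) (-31186897) (by decide +kernel)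
      have hM := X11b.isGloballyMinimal_of_krausCriterion_support 0 (-1) 0 (-203363) (-31186897)
        [(2, 8, 9), (13, 2, 6), (19, 2, 6)] (by decide +kernel) (by decide +kernel) (by decide +kernel)
      haveI : Fact (Nat.Prime 7) := ⟨by norm_num⟩
      exact @bsdp_three_of_ainvs_of_ctpGram hGZK 0 (-1) 0 (-203363) (-31186897) _ hE hM
        (@integralModelInt_eq_of_map_eq _ hM _ (map_mk_int _ _ _ _ _)) 7 8 _ (by decide) (by decide +kernel)
        card_c256a1Dm247_7 (by decide +kernel) hr hcard Q _ B x₁ x₂ hx₁ hx₂ h₁₁ h₂₂ h₁₂ h₂₁ q hq hv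
    
end Summit.BirchSwinnertonDyer.Rank1Residual.X10

end
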